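import Summits.CriticalPhenomena.PercolationContinuityZ3.Theorems.Transplant.SkelPhiPrisms
import Summits.CriticalPhenomena.PercolationContinuityZ3.Theorems.Transplant.SkelCylRadFrame
import Literature.Probability.Percolation.SitePaths
import HarnessLib

/-!
# D″ node, STRUCTURE-FREE base layer, part 2 (SHEAR-SCOPE §3.14 ruling (B″), V98 p3 column, L4′): the HYPOTHESIS DICTIONARY of the φ-level
# layer (`Lip`, `Frames`, `Steps`, `CylConn`) and the FAT PRISMS `Skelφ.cylBall G φ t ℓ R` of a bare planar map `φ : V → ℤ²` — finiteness,
# monotonicity, internal connectivity, frame images, images under coordinate maps preserving `Λ_ℓ`, the comparison radii `cylRad` / `cylRadMax`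
# and the cross-centre nesting — φ-level re-cut of `SkelCylBall` §1–§3, `PlanarSkeletonConcDefs` (ψ′), `SkelCylRadFrame`, `SkelCylBallNest`

builds on p205010 (kernel theorem, internal audit signed; external expert review pending) — nothing in this file uses p205010.
Lane `prim-bschramm`, seat `prim-bschramm-p3` (gen 7; design owner, V98 p3 column); helper file (`--supports stmt-CriticalPhenomena-4575`).
Every statement takes exactly the structure field it uses as a hypothesis, spelled through the dictionary of §0 (each entry is LITERALLY the
field's type, so `Φ.lip : Skelφ.Lip G Φ.φ`, `Φ.frame : Skelφ.Frames G Φ.φ Φ.types`, `Φ.cyl_connected : Skelφ.CylConn G Φ.φ Φ.types` for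
`PlanarSkeleton(Conc)`, `PlanarSkeletonNeg`, `PlanarSkeletonSign` alike — bridges in §7); so ONE layer serves the node of record, both D″ nodes and
the planar part of the rank-`m` skeletons.  The Φ-free walk lemmas of `SkelCylBall` (`Skel.exists_walk_induce_map/mono`, `Skel.pathIn_cylBall_aux`)
and `PlanarSkeletonConc.exists_walk_of_induce` are imported, not re-declared.
* §0 `Skelφ.Lip`, `Skelφ.Frames`, `Skelφ.Steps`, `Skelφ.CylConn` (+ `CylConn.connected`);
* §1 `cyl_mono`, `cylBall_finite`, `cylBallFin`, `mem_cylBallFin`, `cylBall_subset_prismAt`, `cylBall_mono`, `mem_cylBall_succ_of_adj`;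
* §2 **`pathIn_cylBall`** (every point of a fat prism is joined to the centre INSIDE it), `pathIn_cylBall'`;
* §3 `mapsTo_cyl_of_frame`, `image_cylBall_subset_of_frame`, `frame_symm`, **`image_cylBall_of_frame`** (`α t = c`, `φ ∘ α = φ + (φ c − φ t)` ⇒
  `α '' cylBall t ℓ R = cylBall c ℓ R`), `exists_frame_image_cylBall` (from `Frames`), **`image_cylBall_of_boxMap`** (`α t = t`, `φ ∘ α − φ t =
  f (φ − φ t)` for ANY `f` preserving `Λ_ℓ` — covers `sp g`, the central inversion and the axis flips at once);
* §4 `cylRad G φ t ℓ ψ`, `dist_le_cylRad`, **`graphBall_inter_cyl_subset_cylBall`** (hypothesis: THIS induced cylinder is connected), `cylRad_mono`,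
  `prism_sandwich`;
* §5 `cylRadMax G φ types ℓ ψ`, `cylRad_le_cylRadMax`, `cylRadMax_mono`, `prism_subset_cylBall_of_mem` (base vertex, from `CylConn`),
  **`prism_subset_cylBall`** (EVERY centre, from `Frames` + `CylConn`), `graphBall_inter_cyl_subset_cylBall'`;
* §6 `cylBall_subset_cylBall_of_mem` (induced triangle inequality), `cyl_subset_cyl_of_sub_mem_box`, `prism_subset_cylBall_of_near`;
* §7 bridges (`rfl`): `PlanarSkeletonConc.cylBall_eq_skelφ / cylRad_eq_skelφ / cylRadMax_eq_skelφ`, and the dictionary entries of the four structures.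
[cite: KozmaNitzan2024, §4 p. 19 (the wired cube), p. 20 ((22)–(23): the lattice symmetries place the local objects)]
[cite: GrimmettPercolation1999, §1.6 (paths)]
-/

noncomputable section

namespace Summit.CriticalPhenomena.PercolationContinuityZ3.Theorems.Transplant

namespace Skelφ

open Literature.Probability.Percolation Literature.Probability.LatticeModels SimpleGraph
open Literature.Barriers.CriticalPhenomena (graphBall graphBall_finite mem_graphBall_self graphBall_mono mem_graphBall_map)
open scoped Classical

variable {V : Type}

/-! ## §0 The hypothesis dictionary of the φ-level layer (each entry is literally the corresponding structure field's type) -/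

/-- **(lip)** `φ` is `1`-Lipschitz in the sup-norm along edges (the type of the field `PlanarSkeleton(Neg).lip`). [this work] -/
def Lip (G : SimpleGraph V) (φ : V → Site 2) : Prop := ∀ ⦃u v : V⦄, G.Adj u v → ∀ i : Fin 2, |φ u i - φ v i| ≤ 1

/-- **(frame)** every vertex is the image of a base vertex `t ∈ types` under an automorphism translating `φ` (the type of the field
`PlanarSkeleton(Neg).frame`). [this work] -/
def Frames (G : SimpleGraph V) (φ : V → Site 2) (types : Finset V) : Prop :=
  ∀ v : V, ∃ t ∈ types, ∃ α : G ≃g G, α t = v ∧ ∀ w, φ (α w) = φ w + (φ v - φ t)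

/-- **(ι) steps** outward unit steps in every skeleton direction at every vertex (the type of the field `PlanarSkeletonConc/Neg.step`).
[this work] -/
def Steps (G : SimpleGraph V) (φ : V → Site 2) : Prop :=
  ∀ (v : V) (i : Fin 2) (σ : ℤˣ), ∃ v' : V, G.Adj v v' ∧ φ v' = φ v + Pi.single i (σ : ℤ)

/-- **(κ) connected cylinders** the graph induced on each cylinder of half-width `ℓ ≥ 1` at a base vertex is connected (the type of the field
`PlanarSkeletonConc/Neg.cyl_connected`). [this work] -/
def CylConn (G : SimpleGraph V) (φ : V → Site 2) (types : Finset V) : Prop :=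
  ∀ t ∈ types, ∀ ℓ : ℕ, 1 ≤ ℓ → (G.induce {w | φ w - φ t ∈ box 2 ℓ}).Connected

/-- (κ) read through `Skelφ.cyl`. [folklore] -/
theorem CylConn.connected {G : SimpleGraph V} {φ : V → Site 2} {types : Finset V} (hκ : CylConn G φ types) {t : V} (ht : t ∈ types)
    {ℓ : ℕ} (hℓ : 1 ≤ ℓ) : (G.induce (cyl φ t ℓ)).Connected :=
  hκ t ht ℓ hℓ

variable (G : SimpleGraph V) (φ : V → Site 2)

/-! ## §1 Finiteness, monotonicity, one-step growth of fat prisms -/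

/-- Cylinders grow with the half-width. [folklore] -/
theorem cyl_mono (t : V) {ℓ ℓ' : ℕ} (hℓ : ℓ ≤ ℓ') : cyl φ t ℓ ⊆ cyl φ t ℓ' := fun v hv => by
  rw [mem_cyl] at hv ⊢; exact box_mono 2 hℓ hv

/-- Fat prisms are finite in a locally finite graph. [folklore] -/
theorem cylBall_finite [G.LocallyFinite] (t : V) (ℓ R : ℕ) : (cylBall G φ t ℓ R).Finite :=
  (graphBall_finite G t R).subset fun _ hv => (cylBall_subset_prism G φ t ℓ R hv).1

/-- The fat prism as a `Finset`. [folklore] -/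
def cylBallFin [G.LocallyFinite] (t : V) (ℓ R : ℕ) : Finset V := (cylBall_finite G φ t ℓ R).toFinset

/-- Membership in `cylBallFin`. [folklore] -/
@[simp] theorem mem_cylBallFin [G.LocallyFinite] {t : V} {ℓ R : ℕ} {v : V} : v ∈ cylBallFin G φ t ℓ R ↔ v ∈ cylBall G φ t ℓ R := by
  rw [cylBallFin, Set.Finite.mem_toFinset]

/-- Fat prisms lie in the prisms `prismAt t R Λ_ℓ`. [folklore] -/
theorem cylBall_subset_prismAt (t : V) (ℓ R : ℕ) : cylBall G φ t ℓ R ⊆ prismAt G φ t R ↑(box 2 ℓ) := by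
  rw [← prism_eq_prismAt]; exact cylBall_subset_prism G φ t ℓ R

/-- Fat prisms grow with the half-width and the radius. [folklore] -/
theorem cylBall_mono (t : V) {ℓ ℓ' : ℕ} (hℓ : ℓ ≤ ℓ') {R R' : ℕ} (hR : R ≤ R') : cylBall G φ t ℓ R ⊆ cylBall G φ t ℓ' R' := by
  rintro _ ⟨y, ⟨w, hw⟩, rfl⟩
  obtain ⟨w', hw'⟩ := Skel.exists_walk_induce_mono (G := G) (cyl_mono φ t hℓ) w
  exact ⟨⟨y, cyl_mono φ t hℓ y.2⟩, ⟨w', by rw [hw']; exact hw.trans hR⟩, rfl⟩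

/-- A `G`-neighbour, inside the larger cylinder, of a point of `cylBall t ℓ R` lies in `cylBall t ℓ' (R + 1)` (`ℓ ≤ ℓ'`). [folklore] -/
theorem mem_cylBall_succ_of_adj (t : V) {ℓ ℓ' : ℕ} (hℓ : ℓ ≤ ℓ') {R : ℕ} {w v : V} (hw : w ∈ cylBall G φ t ℓ R) (hadj : G.Adj w v)
    (hv : v ∈ cyl φ t ℓ') : v ∈ cylBall G φ t ℓ' (R + 1) := by
  obtain ⟨y, ⟨wk, hwk⟩, rfl⟩ := hw
  obtain ⟨w', hw'⟩ := Skel.exists_walk_induce_mono (G := G) (cyl_mono φ t hℓ) wk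
  have hadj' : (G.induce (cyl φ t ℓ')).Adj ⟨(y : V), cyl_mono φ t hℓ y.2⟩ ⟨v, hv⟩ := SimpleGraph.induce_adj.2 hadj
  refine ⟨⟨v, hv⟩, ⟨w'.append (SimpleGraph.Walk.cons hadj' SimpleGraph.Walk.nil), ?_⟩, rfl⟩
  rw [SimpleGraph.Walk.length_append, hw', SimpleGraph.Walk.length_cons, SimpleGraph.Walk.length_nil]
  omega

/-! ## §2 Internal connectivity (the wired-source obligation (C1)) -/

/-- **Fat prisms are internally connected from their centre**: every `y ∈ cylBall t ℓ R` is joined to `t` by a path of `G` all of whose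
vertices lie in `cylBall t ℓ R`. [cite: KozmaNitzan2024, §4 p. 19 (the wired cube)] -/
theorem pathIn_cylBall {t : V} {ℓ R : ℕ} {y : V} (hy : y ∈ cylBall G φ t ℓ R) : PathIn G (cylBall G φ t ℓ R) t y := by
  obtain ⟨y', ⟨w, hw⟩, rfl⟩ := hy
  exact Skel.pathIn_cylBall_aux (G := G) ⟨t, self_mem_cyl φ t ℓ⟩ R w .nil (by simpa using hw)

/-- Any two points of a fat prism are joined inside it (through the centre). [folklore] -/
theorem pathIn_cylBall' {t : V} {ℓ R : ℕ} {x y : V} (hx : x ∈ cylBall G φ t ℓ R) (hy : y ∈ cylBall G φ t ℓ R) :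
    PathIn G (cylBall G φ t ℓ R) x y :=
  (pathIn_cylBall G φ hx).symm.trans (pathIn_cylBall G φ hy)

/-! ## §3 Frame images and images under `Λ_ℓ`-preserving coordinate maps -/

variable {G φ}

/-- A frame carries the cylinder at `t` into the cylinder at `c`. [folklore] -/
theorem mapsTo_cyl_of_frame {α : G ≃g G} {t c : V} (hφ : ∀ w, φ (α w) = φ w + (φ c - φ t)) (ℓ : ℕ) :
    Set.MapsTo α (cyl φ t ℓ) (cyl φ c ℓ) := by
  intro w hw
  rw [mem_cyl] at hw ⊢
  rwa [hφ w, show φ w + (φ c - φ t) - φ c = φ w - φ t by abel]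

/-- One inclusion of the frame image. [folklore] -/
theorem image_cylBall_subset_of_frame {α : G ≃g G} {t c : V} (hαt : α t = c) (hφ : ∀ w, φ (α w) = φ w + (φ c - φ t)) (ℓ R : ℕ) :
    α '' cylBall G φ t ℓ R ⊆ cylBall G φ c ℓ R := by
  rintro _ ⟨_, ⟨y, ⟨w, hw⟩, rfl⟩, rfl⟩
  have hmap := mapsTo_cyl_of_frame hφ ℓ
  obtain ⟨w', hw'⟩ := Skel.exists_walk_induce_map (G := G) α (fun _ _ h => α.map_adj_iff.2 h) hmap w
  have ht : (⟨α t, hmap (self_mem_cyl φ t ℓ)⟩ : cyl φ c ℓ) = ⟨c, self_mem_cyl φ c ℓ⟩ := Subtype.ext hαt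
  refine ⟨⟨α y, hmap y.2⟩, ⟨w'.copy ht rfl, ?_⟩, rfl⟩
  rw [SimpleGraph.Walk.length_copy, hw']; exact hw

/-- The inverse of a frame is a frame in the opposite direction. [folklore] -/
theorem frame_symm {α : G ≃g G} {t c : V} (hαt : α t = c) (hφ : ∀ w, φ (α w) = φ w + (φ c - φ t)) :
    α.symm c = t ∧ ∀ w, φ (α.symm w) = φ w + (φ t - φ c) := by
  refine ⟨by rw [← hαt, RelIso.symm_apply_apply], fun w => ?_⟩
  have h := hφ (α.symm w)
  rw [RelIso.apply_symm_apply] at h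
  rw [h]; abel

/-- **Frame images of fat prisms are fat prisms — exactly** (no shear): `α t = c`, `φ ∘ α = φ + (φ c − φ t)` give
`α '' cylBall t ℓ R = cylBall c ℓ R`. [cite: KozmaNitzan2024, §4 p. 20 ((22)–(23))] -/
theorem image_cylBall_of_frame {α : G ≃g G} {t c : V} (hαt : α t = c) (hφ : ∀ w, φ (α w) = φ w + (φ c - φ t)) (ℓ R : ℕ) :
    α '' cylBall G φ t ℓ R = cylBall G φ c ℓ R := by
  refine Set.Subset.antisymm (image_cylBall_subset_of_frame hαt hφ ℓ R) fun v hv => ?_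
  obtain ⟨hs, hφ'⟩ := frame_symm hαt hφ
  exact ⟨α.symm v, image_cylBall_subset_of_frame hs hφ' ℓ R ⟨v, hv, rfl⟩, RelIso.apply_symm_apply α v⟩

/-- **Every fat prism is the frame image of a fat prism at a base vertex** (from `Frames`). [folklore] -/
theorem exists_frame_image_cylBall {types : Finset V} (hfr : Frames G φ types) (c : V) (ℓ R : ℕ) :
    ∃ t ∈ types, ∃ α : G ≃g G, α t = c ∧ α '' cylBall G φ t ℓ R = cylBall G φ c ℓ R := by
  obtain ⟨t, ht, α, hαt, hφ⟩ := hfr c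
  exact ⟨t, ht, α, hαt, image_cylBall_of_frame hαt hφ ℓ R⟩

/-- **Automorphisms fixing `t` and acting on `φ − φ t` by a `Λ_ℓ`-preserving map fix the fat prisms at `t`**: `α t = t`,
`φ (α w) − φ t = f (φ w − φ t)` and `f y ∈ Λ_ℓ ↔ y ∈ Λ_ℓ` give `α '' cylBall t ℓ R = cylBall t ℓ R` (the signed permutations `sp g`, the
central inversion `y ↦ −y` and the axis flips are such `f`). [cite: KozmaNitzan2024, §4 p. 20 ((22)–(23))] -/
theorem image_cylBall_of_boxMap {α : G ≃g G} {t : V} (hαt : α t = t) {f : Site 2 → Site 2} (hφ : ∀ w, φ (α w) - φ t = f (φ w - φ t))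
    {ℓ : ℕ} (hbox : ∀ y : Site 2, f y ∈ box 2 ℓ ↔ y ∈ box 2 ℓ) (R : ℕ) : α '' cylBall G φ t ℓ R = cylBall G φ t ℓ R := by
  -- both `α` and `α.symm` map the cylinder at `t` into itself and fix `t`
  have hmap : ∀ β : G ≃g G, β t = t → (∀ w, φ (β w) - φ t ∈ box 2 ℓ ↔ φ w - φ t ∈ box 2 ℓ) →
      β '' cylBall G φ t ℓ R ⊆ cylBall G φ t ℓ R := by
    intro β hβt hβ
    rintro _ ⟨_, ⟨y, ⟨w, hw⟩, rfl⟩, rfl⟩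
    have hm : Set.MapsTo β (cyl φ t ℓ) (cyl φ t ℓ) := fun w hw => by
      rw [mem_cyl] at hw ⊢; exact (hβ w).2 hw
    obtain ⟨w', hw'⟩ := Skel.exists_walk_induce_map (G := G) β (fun _ _ h => β.map_adj_iff.2 h) hm w
    have ht : (⟨β t, hm (self_mem_cyl φ t ℓ)⟩ : cyl φ t ℓ) = ⟨t, self_mem_cyl φ t ℓ⟩ := Subtype.ext hβt
    refine ⟨⟨β y, hm y.2⟩, ⟨w'.copy ht rfl, ?_⟩, rfl⟩
    rw [SimpleGraph.Walk.length_copy, hw']; exact hw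
  have hα : ∀ w, φ (α w) - φ t ∈ box 2 ℓ ↔ φ w - φ t ∈ box 2 ℓ := fun w => by rw [hφ w]; exact hbox _
  have hsymm_t : α.symm t = t := by rw [← hαt, RelIso.symm_apply_apply, hαt]
  have hαs : ∀ w, φ (α.symm w) - φ t ∈ box 2 ℓ ↔ φ w - φ t ∈ box 2 ℓ := fun w => by
    have h := hφ (α.symm w)
    rw [RelIso.apply_symm_apply] at h
    rw [← hbox (φ (α.symm w) - φ t), ← h]
  refine Set.Subset.antisymm (hmap α hαt hα) fun v hv => ?_
  exact ⟨α.symm v, hmap α.symm hsymm_t hαs ⟨v, hv, rfl⟩, RelIso.apply_symm_apply α v⟩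

/-! ## §4 The comparison radius ψ′ between graph-ball prisms and fat prisms -/

variable (G φ)

/-- **The comparison radius `ψ′ = cylRad t ℓ ψ`**: the largest INDUCED-cylinder distance from `t` to a vertex of the graph-ball prism
`graphBall t ψ ∩ cyl t ℓ` (vertices of the prism not reachable inside the cylinder contribute `0`). [this work] -/
def cylRad [G.LocallyFinite] (t : V) (ℓ ψ : ℕ) : ℕ :=
  (graphBall_finite G t ψ).toFinset.sup fun w =>
    if h : w ∈ cyl φ t ℓ then (G.induce (cyl φ t ℓ)).dist ⟨t, self_mem_cyl φ t ℓ⟩ ⟨w, h⟩ else 0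

/-- The induced-cylinder distance from the centre to a prism vertex is at most `cylRad`. [folklore] -/
theorem dist_le_cylRad [G.LocallyFinite] (t : V) (ℓ ψ : ℕ) {w : V} (hw : w ∈ graphBall G t ψ) (hc : w ∈ cyl φ t ℓ) :
    (G.induce (cyl φ t ℓ)).dist ⟨t, self_mem_cyl φ t ℓ⟩ ⟨w, hc⟩ ≤ cylRad G φ t ℓ ψ := by
  have hmem : w ∈ (graphBall_finite G t ψ).toFinset := (Set.Finite.mem_toFinset _).2 hw
  unfold cylRad
  refine le_trans (le_of_eq ?_) (Finset.le_sup hmem)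
  simp only [dif_pos hc]

variable {G φ} in
/-- **Graph-ball prisms sit inside fat prisms of radius `ψ′`** when THIS induced cylinder is connected:
`graphBall t ψ ∩ cyl t ℓ ⊆ cylBall t ℓ (cylRad t ℓ ψ)`. [this work] -/
theorem graphBall_inter_cyl_subset_cylBall [G.LocallyFinite] {t : V} {ℓ : ℕ} (hκt : (G.induce (cyl φ t ℓ)).Connected) (ψ : ℕ) :
    graphBall G t ψ ∩ cyl φ t ℓ ⊆ cylBall G φ t ℓ (cylRad G φ t ℓ ψ) := by
  rintro w ⟨hw, hc⟩
  obtain ⟨p, hp⟩ := (hκt.preconnected ⟨t, self_mem_cyl φ t ℓ⟩ ⟨w, hc⟩).exists_walk_length_eq_dist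
  refine ⟨⟨w, hc⟩, ⟨p, ?_⟩, rfl⟩
  rw [hp]
  exact dist_le_cylRad G φ t ℓ ψ hw hc

/-- `cylRad` is monotone in the prism radius. [folklore] -/
theorem cylRad_mono [G.LocallyFinite] (t : V) (ℓ : ℕ) {ψ ψ' : ℕ} (h : ψ ≤ ψ') : cylRad G φ t ℓ ψ ≤ cylRad G φ t ℓ ψ' := by
  refine Finset.sup_mono ?_
  intro w hw
  rw [Set.Finite.mem_toFinset] at hw ⊢
  exact graphBall_mono G t h hw

variable {G φ} in
/-- Two-sided sandwich at a connected cylinder: the graph-ball prism lies in the fat prism of radius `ψ′`, which lies in the prism of radius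
`ψ′`. [folklore] -/
theorem prism_sandwich [G.LocallyFinite] {t : V} {ℓ : ℕ} (hκt : (G.induce (cyl φ t ℓ)).Connected) (ψ : ℕ) :
    graphBall G t ψ ∩ cyl φ t ℓ ⊆ cylBall G φ t ℓ (cylRad G φ t ℓ ψ) ∧
      cylBall G φ t ℓ (cylRad G φ t ℓ ψ) ⊆ prism G φ t (cylRad G φ t ℓ ψ) ℓ :=
  ⟨graphBall_inter_cyl_subset_cylBall hκt ψ, cylBall_subset_prism G φ t ℓ _⟩

/-! ## §5 The type-uniform comparison radius and `prism ⊆ cylBall` at EVERY centre -/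

/-- **The type-uniform comparison radius** `ψ′_max(ℓ, ψ) := max over `types` of `cylRad t ℓ ψ`. [this work] -/
def cylRadMax [G.LocallyFinite] (types : Finset V) (ℓ ψ : ℕ) : ℕ := types.sup fun t => cylRad G φ t ℓ ψ

/-- Each base vertex's comparison radius is at most the maximum. [folklore] -/
theorem cylRad_le_cylRadMax [G.LocallyFinite] {types : Finset V} {t : V} (ht : t ∈ types) (ℓ ψ : ℕ) :
    cylRad G φ t ℓ ψ ≤ cylRadMax G φ types ℓ ψ :=
  Finset.le_sup (f := fun t => cylRad G φ t ℓ ψ) ht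

/-- `cylRadMax` is monotone in the prism radius. [folklore] -/
theorem cylRadMax_mono [G.LocallyFinite] (types : Finset V) (ℓ : ℕ) {ψ ψ' : ℕ} (h : ψ ≤ ψ') :
    cylRadMax G φ types ℓ ψ ≤ cylRadMax G φ types ℓ ψ' :=
  Finset.sup_mono_fun fun t _ => cylRad_mono G φ t ℓ h

variable {G φ}

/-- At a BASE vertex (from (κ)): the prism of radius `ψ` and half-width `ℓ ≥ 1` lies in the fat prism of radius `cylRadMax ℓ ψ`. [this work] -/
theorem prism_subset_cylBall_of_mem [G.LocallyFinite] {types : Finset V} (hκ : CylConn G φ types) {t : V} (ht : t ∈ types) {ℓ : ℕ}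
    (hℓ : 1 ≤ ℓ) (ψ : ℕ) : prism G φ t ψ ℓ ⊆ cylBall G φ t ℓ (cylRadMax G φ types ℓ ψ) := fun _ hw =>
  cylBall_mono G φ t le_rfl (cylRad_le_cylRadMax G φ ht ℓ ψ) (graphBall_inter_cyl_subset_cylBall (hκ.connected ht hℓ) ψ ⟨hw.1, hw.2⟩)

/-- **At EVERY centre** `c` (from `Frames` + (κ), transported from `c`'s base vertex by one frame): `prism c ψ ℓ ⊆ cylBall c ℓ (cylRadMax ℓ ψ)`
for `ℓ ≥ 1` — the containment "kit cube / seed prism ⊆ fat prism" where the graph metric and the induced-cylinder metric differ. [this work] -/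
theorem prism_subset_cylBall [G.LocallyFinite] {types : Finset V} (hfr : Frames G φ types) (hκ : CylConn G φ types) (c : V) {ℓ : ℕ}
    (hℓ : 1 ≤ ℓ) (ψ : ℕ) : prism G φ c ψ ℓ ⊆ cylBall G φ c ℓ (cylRadMax G φ types ℓ ψ) := by
  obtain ⟨t, ht, α, hαt, hφ⟩ := hfr c
  have h1 : α '' prism G φ t ψ ℓ = prism G φ c ψ ℓ := by
    rw [prism_eq_prismAt, prism_eq_prismAt]; exact image_prismAt_of_frame hαt hφ ψ _
  rw [← h1, ← image_cylBall_of_frame hαt hφ ℓ (cylRadMax G φ types ℓ ψ)]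
  exact Set.image_mono (prism_subset_cylBall_of_mem hκ ht hℓ ψ)

/-- The same containment in the `graphBall ∩ cyl` spelling. [folklore] -/
theorem graphBall_inter_cyl_subset_cylBall' [G.LocallyFinite] {types : Finset V} (hfr : Frames G φ types) (hκ : CylConn G φ types)
    (c : V) {ℓ : ℕ} (hℓ : 1 ≤ ℓ) (ψ : ℕ) : graphBall G c ψ ∩ cyl φ c ℓ ⊆ cylBall G φ c ℓ (cylRadMax G φ types ℓ ψ) := fun _ hw =>
  prism_subset_cylBall hfr hκ c hℓ ψ ⟨hw.1, hw.2⟩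

/-! ## §6 Cross-centre nesting (the induced triangle inequality) -/

/-- **Cross-centre nesting**: `c' ∈ cylBall t ℓ R₀` and `cyl c' m ⊆ cyl t ℓ` give `cylBall c' m ψ ⊆ cylBall t ℓ (R₀ + ψ)`. [folklore] -/
theorem cylBall_subset_cylBall_of_mem {t c' : V} {ℓ m R₀ ψ : ℕ} (hc : c' ∈ cylBall G φ t ℓ R₀) (hcyl : cyl φ c' m ⊆ cyl φ t ℓ) :
    cylBall G φ c' m ψ ⊆ cylBall G φ t ℓ (R₀ + ψ) := by
  rintro _ ⟨y, ⟨w, hw⟩, rfl⟩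
  obtain ⟨z, ⟨q, hq⟩, hz⟩ := hc
  obtain ⟨w', hw'⟩ := Skel.exists_walk_induce_mono (G := G) hcyl w
  have hzc : z = ⟨c', hcyl (self_mem_cyl φ c' m)⟩ := Subtype.ext hz
  subst hzc
  refine ⟨⟨(y : V), hcyl y.2⟩, ⟨q.append w', ?_⟩, rfl⟩
  rw [SimpleGraph.Walk.length_append, hw']
  exact Nat.add_le_add hq hw

/-- **Planar side condition for cylinder nesting**: `φ c' − φ t ∈ Λ_k` and `m + k ≤ ℓ` give `cyl c' m ⊆ cyl t ℓ`. [folklore] -/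
theorem cyl_subset_cyl_of_sub_mem_box {t c' : V} {k m ℓ : ℕ} (hk : φ c' - φ t ∈ box 2 k) (hml : m + k ≤ ℓ) :
    cyl φ c' m ⊆ cyl φ t ℓ := by
  intro w hw
  rw [mem_cyl] at hw ⊢
  rw [mem_box] at hw hk ⊢
  intro i
  obtain ⟨h1, h1'⟩ := hw i
  obtain ⟨h2, h2'⟩ := hk i
  have e : (φ w - φ t) i = (φ w - φ c') i + (φ c' - φ t) i := by simp only [Pi.sub_apply]; ring
  have hml' : (m : ℤ) + k ≤ ℓ := by exact_mod_cast hml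
  rw [e]
  constructor <;> linarith

/-- **The graph-ball prism of a NEARBY centre inside a fat prism**: `c' ∈ graphBall t r ∩ cyl t ℓ`, `cyl c' m ⊆ cyl t ℓ`, `1 ≤ ℓ`, `1 ≤ m` give
`prism c' ψ m ⊆ cylBall t ℓ (cylRadMax ℓ r + cylRadMax m ψ)` — every radius on the right is a constant of `(φ, types, ℓ, m, r, ψ)`. [this work] -/
theorem prism_subset_cylBall_of_near [G.LocallyFinite] {types : Finset V} (hfr : Frames G φ types) (hκ : CylConn G φ types) {t c' : V}
    {ℓ m r ψ : ℕ} (hℓ : 1 ≤ ℓ) (hm : 1 ≤ m) (hc : c' ∈ graphBall G t r) (hc' : c' ∈ cyl φ t ℓ) (hcyl : cyl φ c' m ⊆ cyl φ t ℓ) :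
    prism G φ c' ψ m ⊆ cylBall G φ t ℓ (cylRadMax G φ types ℓ r + cylRadMax G φ types m ψ) :=
  (prism_subset_cylBall hfr hκ c' hm ψ).trans
    (cylBall_subset_cylBall_of_mem (prism_subset_cylBall hfr hκ t hℓ r ⟨hc, hc'⟩) hcyl)

end Skelφ

/-! ## §7 Bridges (`rfl`): the structures' fat prisms / radii / fields are the φ-level ones -/

namespace PlanarSkeletonConc

open Literature.Probability.LatticeModels

variable {V : Type} {G : SimpleGraph V} [G.LocallyFinite] (Φ : PlanarSkeletonConc G)

/-- `PlanarSkeletonConc.cylBall` is the φ-level fat prism of `Φ.φ`. [folklore] -/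
theorem cylBall_eq_skelφ (t : V) (ℓ R : ℕ) : Φ.cylBall t ℓ R = Skelφ.cylBall G Φ.φ t ℓ R := rfl

/-- `PlanarSkeletonConc.cylRad` is the φ-level comparison radius of `Φ.φ`. [folklore] -/
theorem cylRad_eq_skelφ (t : V) (ℓ ψ : ℕ) : Φ.cylRad t ℓ ψ = Skelφ.cylRad G Φ.φ t ℓ ψ := rfl

/-- `PlanarSkeletonConc.cylRadMax` is the φ-level `cylRadMax` of `(Φ.φ, Φ.types)`. [folklore] -/
theorem cylRadMax_eq_skelφ (ℓ ψ : ℕ) : Φ.cylRadMax ℓ ψ = Skelφ.cylRadMax G Φ.φ Φ.types ℓ ψ := rfl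

/-- The dictionary entries of a `PlanarSkeletonConc`: (lip). [folklore] -/
theorem lip_skelφ : Skelφ.Lip G Φ.φ := Φ.lip

/-- (frame). [folklore] -/
theorem frames_skelφ : Skelφ.Frames G Φ.φ Φ.types := Φ.frame

/-- (ι). [folklore] -/
theorem steps_skelφ : Skelφ.Steps G Φ.φ := Φ.step

/-- (κ). [folklore] -/
theorem cylConn_skelφ : Skelφ.CylConn G Φ.φ Φ.types := Φ.cyl_connected

end PlanarSkeletonConc

namespace PlanarSkeleton

variable {V : Type} {G : SimpleGraph V} (Φ : PlanarSkeleton G)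

/-- The dictionary entries of a `PlanarSkeleton`: (lip). [folklore] -/
theorem lip_skelφ : Skelφ.Lip G Φ.φ := Φ.lip

/-- (frame). [folklore] -/
theorem frames_skelφ : Skelφ.Frames G Φ.φ Φ.types := Φ.frame

end PlanarSkeleton

namespace PlanarSkeletonNeg

open Literature.Probability.LatticeModels

variable {V : Type} {G : SimpleGraph V} [G.LocallyFinite] (Φ : PlanarSkeletonNeg G)

/-- The dictionary entries of a `PlanarSkeletonNeg` (hence of a `PlanarSkeletonSign` through `toPlanarSkeletonNeg`): (lip). [folklore] -/
theorem lip_skelφ : Skelφ.Lip G Φ.φ := Φ.lip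

/-- (frame). [folklore] -/
theorem frames_skelφ : Skelφ.Frames G Φ.φ Φ.types := Φ.frame

/-- (ι). [folklore] -/
theorem steps_skelφ : Skelφ.Steps G Φ.φ := Φ.step

/-- (κ). [folklore] -/
theorem cylConn_skelφ : Skelφ.CylConn G Φ.φ Φ.types := Φ.cyl_connected

/-- The central inversion fixes the fat prisms at a base vertex (`image_cylBall_of_boxMap` with `f = (− ·)`). [cite: KozmaNitzan2024, §4 p. 20 ((22)–(23))] -/
theorem exists_neg_image_cylBall {t : V} (ht : t ∈ Φ.types) (ℓ R : ℕ) :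
    ∃ α : G ≃g G, α t = t ∧ (∀ w, Φ.φ (α w) - Φ.φ t = -(Φ.φ w - Φ.φ t)) ∧ α '' Skelφ.cylBall G Φ.φ t ℓ R = Skelφ.cylBall G Φ.φ t ℓ R := by
  obtain ⟨α, hαt, hφ⟩ := Φ.neg t ht
  refine ⟨α, hαt, hφ, Skelφ.image_cylBall_of_boxMap hαt (f := fun y => -y) hφ (fun y => ?_) R⟩
  simp only [mem_box, Pi.neg_apply]
  exact ⟨fun h i => by have := h i; omega, fun h i => by have := h i; omega⟩

end PlanarSkeletonNeg

end Summit.CriticalPhenomena.PercolationContinuityZ3.Theorems.Transplant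

end
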